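import Summits.ResolutionOfSingularities.ResolutionOfSingularities.Theorems.HilbertSamuelEliminationSigmaMaxModificationsCorridor3SigmaBoundaryOffMemberCoincidence
import Summits.ResolutionOfSingularities.ResolutionOfSingularities.Theorems.HilbertSamuelEliminationSigmaMaxModificationsCorridor3SigmaBoundaryMembersLocallyPrincipal
import Summits.ResolutionOfSingularities.ResolutionOfSingularities.Theorems.HilbertSamuelEliminationSigmaMaxModificationsCorridor3SigmaBoundaryElimination
import HarnessLib

/-!
# [OURS · L1 W4.2] σ-LAYER — THE COINCIDENCE PROGRAMME (R-iii) ASSEMBLED: (D1′) and the `MembersLocallyPrincipal` kernel CONSUMED BY NAME;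
# the RUN INVARIANT «all boundary members locally principal» PROVED along σ-runs from a locally principal start; transform-coincidence of a
# `𝓑`-permissible policy on the reachable scopes MODULO THE (D2′) ON-MEMBER OBLIGATION ALONE
# (cell res-hironaka, LADDER-RESOLUTION rung L; slot W4.2, crux chain w42 `SigmaMaxModifications` stmt-ResolutionOfSingularities-18506 / conjunct
# `SigmaMaxModificationsCorridor3` stmt-ResolutionOfSingularities-19249; `--supports stmt-ResolutionOfSingularities-19249 --as helper`; CHAIN v3.26
# (0y.6) «o1: consume 060's `offMemberCoincidenceLaw_holds` by name»; typer res-L1-type-o1 g11)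

OURS bookkeeping, 0 `def`s, every declaration PROVED; NOT a statement of H. Hironaka's manuscript [Hironaka2017] nor of [CossartJannsenSaito2020].
AI-written, weaker than expert review.

## What this closes

`…Corridor3SigmaBoundaryBPermissible` (p552583, §4) assembled `IsTransformCoincidentOnE` from the run invariant `IsBPermissibleOnE` under FOUR inputs:
the (D1′) law `OffMemberCoincidenceLaw W` on the scope's stages (`hlaw`), irreducible centres (`hirr`), `MembersLocallyPrincipal 𝒮` (`hlp`) and the (D2′)
on-member obligation `IsOnMemberCoincidentOnE` (`hon`). Since then two of the four became TREE THEOREMS (res-D-pv-060 g8):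

* `offMemberCoincidenceLaw_holds (W) [IsLocallyNoetherian W] : OffMemberCoincidenceLaw W` (`…SigmaBoundaryOffMemberCoincidence`, p554842);
* `Boundary.Coincides.isLocallyPrincipal_of_mem_next` — the propagation step of `MembersLocallyPrincipal` along a COINCIDING blow-up
  (`…SigmaBoundaryMembersLocallyPrincipal`).

This file consumes both by name:

* §1 — the `hlaw`-FREE forms of p552583 §4: `IsBPermissibleOnE.isOffMemberCoincidentOnE_of_lp`, `isTransformCoincidentOnE_of_isBPermissibleOnE_of_lp`,
  `IsMenuDisciplined.isTransformCoincidentOnE_of_lp`.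
* §2 — THE RUN INVARIANT, PROVED: the generic induction `StateReachesσE.forall_mem_isLocallyPrincipal` / `ReachesσE.forall_mem_isLocallyPrincipal`
  (members stay locally principal along any chain of steps each of which COINCIDES while the members are locally principal), and its instances on the two
  scopes of record — **`membersLocallyPrincipal_runReachableState`** (res-D-pv-047's run-wise scope `StrategyE.RunReachableState p σ N ν E₀`,
  `…SigmaBoundaryElimination`) and **`membersLocallyPrincipal_reachableState`** (o1's marked scope `StrategyE.ReachableState p σ N ν E₀`, p523041) — from:
  locally principal initial members (`E₀ = fun _ _ => []`: nothing to check), `IsBPermissibleOnE`, irreducible centres, and (D2′) on that scope. The point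
  of the induction: the `hlp` input of §1 is NOT an extra hypothesis on a reachable scope — coincidence at step `n` (which needs the members of `E_n`
  locally principal) makes the members of `E_{n+1}` locally principal.
* §3 — THE ASSEMBLY OF RECORD: **`isTransformCoincidentOnE_runReachableState`** / **`isTransformCoincidentOnE_reachableState`** and their
  `IsMenuDisciplined` forms (irreducibility of `plusMenu` centres is p552583 §3): along a `𝓑`-permissible policy with irreducible centres started from
  locally principal members, the boundary of every step in scope IS CJS's complete transform (`Boundary.next_eq_completeTransformList_of_coincides`,
  p547994) **modulo the (D2′) on-member obligation `IsOnMemberCoincidentOnE` alone** (near-point theory: `𝓘_E · B̃ = π^* B` for members containing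
  the centre; NOT implied by `𝓑`-permissibility — two-step specimen `W = V(x³y − z³)` in `…SigmaBoundaryCoincidence`).

VACUITY. Every theorem here has its hypotheses met non-trivially by the policies of record (e.g. any `plusMenu`-disciplined `𝓑`-permissible policy from
`E₀ = []`); the conclusion `MembersLocallyPrincipal` is false for an arbitrary scope (a non-principal member put in by hand), so the reachability
hypothesis carries weight; (D2′) stays an honest obligation (specimen above).

References (context): CJS LNM 2270 Def. 3.1, Def. 5.1, Def. 5.4–5.7 [CossartJannsenSaito2020]; Kollár, Lectures on resolution, Def. 3.65–3.66 [Kollar2007].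
-/

noncomputable section

set_option linter.dupNamespace false -- mandated namespace of this single-conjunct summit

open CategoryTheory AlgebraicGeometry TopologicalSpace
open Summit.ResolutionOfSingularities.ResolutionOfSingularities.Theorems.CampaignW42
open Literature.AlgebraicGeometry.Resolution Literature.RingTheory.HilbertSamuel

namespace Summit.ResolutionOfSingularities.ResolutionOfSingularities.Theorems.SigmaMaxModificationsCorridor3.Sigma

universe u

variable {N : ℕ} {ν : ℕ → ℕ} {σ : StrategyE.{u}}

/-! ## §1. (D1′) consumed by name: the law-free forms of p552583 §4 -/

section LawFree

variable {𝒮 : StateScopeE.{u}}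

/-- **(D1′) on every stage of every scope** — `offMemberCoincidenceLaw_holds` in the shape p552583 §4 takes it (`hlaw`). [folklore] -/
theorem offMemberCoincidenceLaw_onScope (𝒮 : StateScopeE.{u}) :
    ∀ (W : Scheme.{u}) (hW : IsLocallyNoetherian W) (L : Labelling W) (P : Option (Pending W)) (E : Boundary W), 𝒮 W hW L P E →
      OffMemberCoincidenceLaw W :=
  fun W _ _ _ _ _ => offMemberCoincidenceLaw_holds W

/-- **OFF-MEMBER COINCIDENCE from the invariant, law-free**: `𝓑`-permissible centres + irreducible centres + locally principal members ⇒
`IsOffMemberCoincidentOnE` (p552583's `IsBPermissibleOnE.isOffMemberCoincidentOnE` with (D1′) := `offMemberCoincidenceLaw_holds`). [folklore] -/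
theorem StrategyE.IsBPermissibleOnE.isOffMemberCoincidentOnE_of_lp (hB : σ.IsBPermissibleOnE 𝒮 N ν)
    (hirr : ∀ (W : Scheme.{u}) (hW : IsLocallyNoetherian W) (L : Labelling W) (P : Option (Pending W)) (E : Boundary W), 𝒮 W hW L P E →
      ∀ (C : W.IdealSheafData) (P' : Option (Pending (blowup C))), σ.step W hW N ν L P E C P' → IsIrreducible (C.support : Set W))
    (hlp : MembersLocallyPrincipal 𝒮) : σ.IsOffMemberCoincidentOnE 𝒮 N ν :=
  hB.isOffMemberCoincidentOnE (offMemberCoincidenceLaw_onScope 𝒮) hirr hlp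

/-- **TRANSFORM-COINCIDENCE from the invariant, law-free**: `𝓑`-permissible + irreducible centres + locally principal members + (D2′) ⇒
`IsTransformCoincidentOnE`. [folklore] -/
theorem isTransformCoincidentOnE_of_isBPermissibleOnE_of_lp (hB : σ.IsBPermissibleOnE 𝒮 N ν)
    (hirr : ∀ (W : Scheme.{u}) (hW : IsLocallyNoetherian W) (L : Labelling W) (P : Option (Pending W)) (E : Boundary W), 𝒮 W hW L P E →
      ∀ (C : W.IdealSheafData) (P' : Option (Pending (blowup C))), σ.step W hW N ν L P E C P' → IsIrreducible (C.support : Set W))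
    (hlp : MembersLocallyPrincipal 𝒮) (hon : σ.IsOnMemberCoincidentOnE 𝒮 N ν) : σ.IsTransformCoincidentOnE 𝒮 N ν :=
  isTransformCoincidentOnE_of_isBPermissibleOnE hB (offMemberCoincidenceLaw_onScope 𝒮) hirr hlp hon

/-- **The same for a `plusMenu`-DISCIPLINED policy** (irreducible centres by p552583 §3), law-free. [folklore] -/
theorem StrategyE.IsMenuDisciplined.isTransformCoincidentOnE_of_lp (hσ : σ.IsMenuDisciplined N ν) (hB : σ.IsBPermissibleOnE 𝒮 N ν)
    (hlp : MembersLocallyPrincipal 𝒮) (hon : σ.IsOnMemberCoincidentOnE 𝒮 N ν) : σ.IsTransformCoincidentOnE 𝒮 N ν :=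
  hσ.isTransformCoincidentOnE hB (offMemberCoincidenceLaw_onScope 𝒮) hlp hon

/-- **ONE STEP OF THE COINCIDENCE PROGRAMME at a state in scope**: if the members of `E` are locally principal, every step `σ` allows from `(W, L, P, E)`
has a centre under which `E` COINCIDES — off the member by (D1′) (`offMemberCoincidenceLaw_holds`: `C` permissible by the invariant, `V(C)` irreducible,
`B` locally principal), on the member by (D2′). [folklore] -/
theorem StrategyE.IsBPermissibleOnE.coincides_of_forall_isLocallyPrincipal (hB : σ.IsBPermissibleOnE 𝒮 N ν)
    (hirr : ∀ (W : Scheme.{u}) (hW : IsLocallyNoetherian W) (L : Labelling W) (P : Option (Pending W)) (E : Boundary W), 𝒮 W hW L P E →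
      ∀ (C : W.IdealSheafData) (P' : Option (Pending (blowup C))), σ.step W hW N ν L P E C P' → IsIrreducible (C.support : Set W))
    (hon : σ.IsOnMemberCoincidentOnE 𝒮 N ν) {W : Scheme.{u}} {hW : IsLocallyNoetherian W} {L : Labelling W} {P : Option (Pending W)}
    {E : Boundary W} (hS : 𝒮 W hW L P E) (hE : ∀ B ∈ E, IsLocallyPrincipal B) {C : W.IdealSheafData} {P' : Option (Pending (blowup C))}
    (hstep : σ.step W hW N ν L P E C P') : E.Coincides C := by
  intro B hBE
  by_cases hle : B ≤ C
  · exact hon W hW L P E hS C P' hstep B hBE hle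
  · exact offMemberCoincidenceLaw_holds W C B (hB.isPermissible hS hstep) (hirr W hW L P E hS C P' hstep) (hE B hBE) hle

end LawFree

/-! ## §2. The run invariant «all members locally principal», proved -/

section Invariant

/-- **GENERIC INDUCTION, point-free states**: along a chain of boundary-threaded σ-steps from `t₀`, if the members of `t₀.E` are locally principal and
every step from a state REACHED from `t₀` whose members are locally principal COINCIDES, then the members stay locally principal
(step: `Boundary.Coincides.isLocallyPrincipal_of_mem_next`). [folklore] -/
theorem StateReachesσE.forall_mem_isLocallyPrincipal {t₀ t : StateσE.{u}} (h : StateReachesσE σ N ν t₀ t)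
    (h₀ : ∀ B ∈ t₀.E, IsLocallyPrincipal B)
    (hco : ∀ t : StateσE.{u}, StateReachesσE σ N ν t₀ t → (∀ B ∈ t.E, IsLocallyPrincipal B) →
      ∀ (C : t.W.IdealSheafData) (P' : Option (Pending (blowup C))), σ.step t.W t.ln N ν t.L t.P t.E C P' → t.E.Coincides C) :
    ∀ B ∈ t.E, IsLocallyPrincipal B := by
  induction h with
  | refl => exact h₀
  | @tail b _ hreach hst ih =>
    obtain ⟨C, P', hln, hstep, rfl⟩ := hst
    haveI := b.ln
    exact (hco b hreach ih C P' hstep).isLocallyPrincipal_of_mem_next ih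

/-- **GENERIC INDUCTION, marked stages**: the same along o1's boundary-threaded near steps `CanonicalNearStepσE` (p523041). [folklore] -/
theorem ReachesσE.forall_mem_isLocallyPrincipal {s₀ s : MarkedStageE.{u}} (h : ReachesσE σ N ν s₀ s)
    (h₀ : ∀ B ∈ s₀.E, IsLocallyPrincipal B)
    (hco : ∀ s : MarkedStageE.{u}, ReachesσE σ N ν s₀ s → (∀ B ∈ s.E, IsLocallyPrincipal B) →
      ∀ (C : s.W.IdealSheafData) (P' : Option (Pending (blowup C))), σ.step s.W s.ln N ν s.L s.P s.E C P' → s.E.Coincides C) :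
    ∀ B ∈ s.E, IsLocallyPrincipal B := by
  induction h with
  | refl => exact h₀
  | @tail b _ hreach hst ih =>
    obtain ⟨C, P', hln, x', hstep, -, -, -, rfl⟩ := hst
    haveI := b.ln
    exact (hco b hreach ih C P' hstep).isLocallyPrincipal_of_mem_next ih

variable {p : ℕ} {E₀ : ∀ (X : Scheme.{u}), X → Boundary X}

/-- [OURS · L1 W4.2] **THE RUN INVARIANT ON THE RUN-WISE SCOPE**: started from locally principal members at every maximal origin (`E₀ = fun _ _ => []`:
vacuous), a policy that is `𝓑`-permissible, has irreducible centres and meets (D2′) on `StrategyE.RunReachableState p σ N ν E₀` keeps ALL BOUNDARY MEMBERS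
LOCALLY PRINCIPAL on that scope — `MembersLocallyPrincipal (StrategyE.RunReachableState p σ N ν E₀)`. NOT a statement of the manuscript.
[cite: CossartJannsenSaito2020, Def. 5.1, Def. 5.4–5.7 (LNM 2270, p. 67–69)] -/
theorem membersLocallyPrincipal_runReachableState
    (h₀ : ∀ (X : Scheme.{u}) (hX : IsLocallyNoetherian X) (x : X), IsMaximalOrigin p N ν X x → ∀ B ∈ E₀ X x, IsLocallyPrincipal B)
    (hB : σ.IsBPermissibleOnE (StrategyE.RunReachableState p σ N ν E₀) N ν)
    (hirr : ∀ (W : Scheme.{u}) (hW : IsLocallyNoetherian W) (L : Labelling W) (P : Option (Pending W)) (E : Boundary W),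
      StrategyE.RunReachableState p σ N ν E₀ W hW L P E →
      ∀ (C : W.IdealSheafData) (P' : Option (Pending (blowup C))), σ.step W hW N ν L P E C P' → IsIrreducible (C.support : Set W))
    (hon : σ.IsOnMemberCoincidentOnE (StrategyE.RunReachableState p σ N ν E₀) N ν) :
    MembersLocallyPrincipal (StrategyE.RunReachableState p σ N ν E₀) := by
  rintro W hW L P E ⟨X, hX, x, hx, hreach⟩
  refine hreach.forall_mem_isLocallyPrincipal (h₀ X hX x hx) fun t ht hE C P' hstep => ?_
  exact hB.coincides_of_forall_isLocallyPrincipal hirr hon (W := t.W) (hW := t.ln) (L := t.L) (P := t.P) (E := t.E)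
    ⟨X, hX, x, hx, ht⟩ hE hstep

/-- [OURS · L1 W4.2] **THE RUN INVARIANT ON o1's MARKED SCOPE** `StrategyE.ReachableState p σ N ν E₀` (p523041), same hypotheses read on that scope.
NOT a statement of the manuscript. [cite: CossartJannsenSaito2020, Def. 5.1, Def. 5.4–5.7 (LNM 2270, p. 67–69)] -/
theorem membersLocallyPrincipal_reachableState
    (h₀ : ∀ (X : Scheme.{u}) (hX : IsLocallyNoetherian X) (x : X), IsMaximalOrigin p N ν X x → ∀ B ∈ E₀ X x, IsLocallyPrincipal B)
    (hB : σ.IsBPermissibleOnE (StrategyE.ReachableState p σ N ν E₀) N ν)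
    (hirr : ∀ (W : Scheme.{u}) (hW : IsLocallyNoetherian W) (L : Labelling W) (P : Option (Pending W)) (E : Boundary W),
      StrategyE.ReachableState p σ N ν E₀ W hW L P E →
      ∀ (C : W.IdealSheafData) (P' : Option (Pending (blowup C))), σ.step W hW N ν L P E C P' → IsIrreducible (C.support : Set W))
    (hon : σ.IsOnMemberCoincidentOnE (StrategyE.ReachableState p σ N ν E₀) N ν) :
    MembersLocallyPrincipal (StrategyE.ReachableState p σ N ν E₀) := by
  rintro W hW L P E ⟨y, X, hX, x, hx, hreach⟩
  refine hreach.forall_mem_isLocallyPrincipal (s₀ := ⟨@MarkedStage.init X hX x, E₀ X x⟩) (h₀ X hX x hx) fun s hs hE C P' hstep => ?_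
  exact hB.coincides_of_forall_isLocallyPrincipal hirr hon (W := s.W) (hW := s.ln) (L := s.L) (P := s.P) (E := s.E)
    ⟨s.pt, X, hX, x, hx, hs⟩ hE hstep

/-- From the EMPTY initial boundary the start condition is vacuous (run-wise scope). [folklore] -/
theorem membersLocallyPrincipal_runReachableState_nil
    (hB : σ.IsBPermissibleOnE (StrategyE.RunReachableState p σ N ν fun _ _ => []) N ν)
    (hirr : ∀ (W : Scheme.{u}) (hW : IsLocallyNoetherian W) (L : Labelling W) (P : Option (Pending W)) (E : Boundary W),
      StrategyE.RunReachableState p σ N ν (fun _ _ => []) W hW L P E →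
      ∀ (C : W.IdealSheafData) (P' : Option (Pending (blowup C))), σ.step W hW N ν L P E C P' → IsIrreducible (C.support : Set W))
    (hon : σ.IsOnMemberCoincidentOnE (StrategyE.RunReachableState p σ N ν fun _ _ => []) N ν) :
    MembersLocallyPrincipal (StrategyE.RunReachableState p σ N ν fun _ _ => []) :=
  membersLocallyPrincipal_runReachableState (fun _ _ _ _ _ h => by simp at h) hB hirr hon

/-- From the EMPTY initial boundary the start condition is vacuous (marked scope). [folklore] -/
theorem membersLocallyPrincipal_reachableState_nil
    (hB : σ.IsBPermissibleOnE (StrategyE.ReachableState p σ N ν fun _ _ => []) N ν)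
    (hirr : ∀ (W : Scheme.{u}) (hW : IsLocallyNoetherian W) (L : Labelling W) (P : Option (Pending W)) (E : Boundary W),
      StrategyE.ReachableState p σ N ν (fun _ _ => []) W hW L P E →
      ∀ (C : W.IdealSheafData) (P' : Option (Pending (blowup C))), σ.step W hW N ν L P E C P' → IsIrreducible (C.support : Set W))
    (hon : σ.IsOnMemberCoincidentOnE (StrategyE.ReachableState p σ N ν fun _ _ => []) N ν) :
    MembersLocallyPrincipal (StrategyE.ReachableState p σ N ν fun _ _ => []) :=
  membersLocallyPrincipal_reachableState (fun _ _ _ _ _ h => by simp at h) hB hirr hon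

end Invariant

/-! ## §3. The assembly of record: transform-coincidence on the reachable scopes modulo (D2′) alone -/

section Assembly

variable {p : ℕ} {E₀ : ∀ (X : Scheme.{u}), X → Boundary X}

/-- [OURS · L1 W4.2] **TRANSFORM-COINCIDENCE ON THE RUN-WISE SCOPE, MODULO (D2′)**: locally principal initial members + `𝓑`-permissible + irreducible
centres + the on-member obligation on `StrategyE.RunReachableState p σ N ν E₀` ⇒ `IsTransformCoincidentOnE` there — so along every σ-run from a maximal
origin the boundary of record IS CJS's complete transform (`CanonicalNearStepσE.next_E_eq_completeTransformList`, p547994). NOT a statement of the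
manuscript. [cite: CossartJannsenSaito2020, Def. 5.4–5.7 (LNM 2270, p. 68–69)] -/
theorem isTransformCoincidentOnE_runReachableState
    (h₀ : ∀ (X : Scheme.{u}) (hX : IsLocallyNoetherian X) (x : X), IsMaximalOrigin p N ν X x → ∀ B ∈ E₀ X x, IsLocallyPrincipal B)
    (hB : σ.IsBPermissibleOnE (StrategyE.RunReachableState p σ N ν E₀) N ν)
    (hirr : ∀ (W : Scheme.{u}) (hW : IsLocallyNoetherian W) (L : Labelling W) (P : Option (Pending W)) (E : Boundary W),
      StrategyE.RunReachableState p σ N ν E₀ W hW L P E →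
      ∀ (C : W.IdealSheafData) (P' : Option (Pending (blowup C))), σ.step W hW N ν L P E C P' → IsIrreducible (C.support : Set W))
    (hon : σ.IsOnMemberCoincidentOnE (StrategyE.RunReachableState p σ N ν E₀) N ν) :
    σ.IsTransformCoincidentOnE (StrategyE.RunReachableState p σ N ν E₀) N ν :=
  isTransformCoincidentOnE_of_isBPermissibleOnE_of_lp hB hirr (membersLocallyPrincipal_runReachableState h₀ hB hirr hon) hon

/-- [OURS · L1 W4.2] **TRANSFORM-COINCIDENCE ON o1's MARKED SCOPE, MODULO (D2′)** (the scope the rows `…OnE` of p523041 are read on). NOT a statement of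
the manuscript. [cite: CossartJannsenSaito2020, Def. 5.4–5.7 (LNM 2270, p. 68–69)] -/
theorem isTransformCoincidentOnE_reachableState
    (h₀ : ∀ (X : Scheme.{u}) (hX : IsLocallyNoetherian X) (x : X), IsMaximalOrigin p N ν X x → ∀ B ∈ E₀ X x, IsLocallyPrincipal B)
    (hB : σ.IsBPermissibleOnE (StrategyE.ReachableState p σ N ν E₀) N ν)
    (hirr : ∀ (W : Scheme.{u}) (hW : IsLocallyNoetherian W) (L : Labelling W) (P : Option (Pending W)) (E : Boundary W),
      StrategyE.ReachableState p σ N ν E₀ W hW L P E →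
      ∀ (C : W.IdealSheafData) (P' : Option (Pending (blowup C))), σ.step W hW N ν L P E C P' → IsIrreducible (C.support : Set W))
    (hon : σ.IsOnMemberCoincidentOnE (StrategyE.ReachableState p σ N ν E₀) N ν) :
    σ.IsTransformCoincidentOnE (StrategyE.ReachableState p σ N ν E₀) N ν :=
  isTransformCoincidentOnE_of_isBPermissibleOnE_of_lp hB hirr (membersLocallyPrincipal_reachableState h₀ hB hirr hon) hon

/-- [OURS · L1 W4.2] **The `plusMenu`-DISCIPLINED form, run-wise scope, from `E₀ = []`**: a menu-disciplined (`StrategyE.IsMenuDisciplined`, p527045)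
`𝓑`-permissible policy meeting (D2′) on its run-wise scope is transform-coincident there — the two remaining inputs are exactly the invariant of record
(o-D3) and the on-member obligation (D2′). NOT a statement of the manuscript. [cite: CossartJannsenSaito2020, Def. 5.4–5.7 (LNM 2270, p. 68–69)] -/
theorem StrategyE.IsMenuDisciplined.isTransformCoincidentOnE_runReachableState_nil (hσ : σ.IsMenuDisciplined N ν)
    (hB : σ.IsBPermissibleOnE (StrategyE.RunReachableState p σ N ν fun _ _ => []) N ν)
    (hon : σ.IsOnMemberCoincidentOnE (StrategyE.RunReachableState p σ N ν fun _ _ => []) N ν) :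
    σ.IsTransformCoincidentOnE (StrategyE.RunReachableState p σ N ν fun _ _ => []) N ν :=
  isTransformCoincidentOnE_runReachableState (fun _ _ _ _ _ h => by simp at h) hB (fun _ _ _ _ _ _ _ _ hs => hσ.isIrreducible_support hs) hon

/-- [OURS · L1 W4.2] **The `plusMenu`-DISCIPLINED form, marked scope, from `E₀ = []`.** NOT a statement of the manuscript.
[cite: CossartJannsenSaito2020, Def. 5.4–5.7 (LNM 2270, p. 68–69)] -/
theorem StrategyE.IsMenuDisciplined.isTransformCoincidentOnE_reachableState_nil (hσ : σ.IsMenuDisciplined N ν)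
    (hB : σ.IsBPermissibleOnE (StrategyE.ReachableState p σ N ν fun _ _ => []) N ν)
    (hon : σ.IsOnMemberCoincidentOnE (StrategyE.ReachableState p σ N ν fun _ _ => []) N ν) :
    σ.IsTransformCoincidentOnE (StrategyE.ReachableState p σ N ν fun _ _ => []) N ν :=
  isTransformCoincidentOnE_reachableState (fun _ _ _ _ _ h => by simp at h) hB (fun _ _ _ _ _ _ _ _ hs => hσ.isIrreducible_support hs) hon

/-- [OURS · L1 W4.2] **MEMBERS LOCALLY PRINCIPAL along a menu-disciplined `𝓑`-permissible policy from `E₀ = []`** (run-wise scope), modulo (D2′).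
NOT a statement of the manuscript. [cite: CossartJannsenSaito2020, Def. 5.1, Def. 5.7 (LNM 2270, p. 67–69)] -/
theorem StrategyE.IsMenuDisciplined.membersLocallyPrincipal_runReachableState_nil (hσ : σ.IsMenuDisciplined N ν)
    (hB : σ.IsBPermissibleOnE (StrategyE.RunReachableState p σ N ν fun _ _ => []) N ν)
    (hon : σ.IsOnMemberCoincidentOnE (StrategyE.RunReachableState p σ N ν fun _ _ => []) N ν) :
    MembersLocallyPrincipal (StrategyE.RunReachableState p σ N ν fun _ _ => []) :=
  Sigma.membersLocallyPrincipal_runReachableState_nil hB (fun _ _ _ _ _ _ _ _ hs => hσ.isIrreducible_support hs) hon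

/-- **RUN-WISE ⇒ MARKED** (o1's marked scope ⊆ the run-wise one, `StrategyE.reachableState_subset_runReachableState`): every conclusion on the run-wise
scope restricts to the marked scope. [folklore] -/
theorem StrategyE.IsTransformCoincidentOnE.reachableState_of_runReachableState
    (h : σ.IsTransformCoincidentOnE (StrategyE.RunReachableState p σ N ν E₀) N ν) :
    σ.IsTransformCoincidentOnE (StrategyE.ReachableState p σ N ν E₀) N ν :=
  h.mono fun _ _ _ _ _ hS => StrategyE.reachableState_subset_runReachableState hS

/-- **RUN-WISE ⇒ MARKED for the invariant `MembersLocallyPrincipal`.** [folklore] -/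
theorem membersLocallyPrincipal_reachableState_of_runReachableState
    (h : MembersLocallyPrincipal (StrategyE.RunReachableState p σ N ν E₀)) :
    MembersLocallyPrincipal (StrategyE.ReachableState p σ N ν E₀) :=
  fun W hW L P E hS => h W hW L P E (StrategyE.reachableState_subset_runReachableState hS)

end Assembly

end Summit.ResolutionOfSingularities.ResolutionOfSingularities.Theorems.SigmaMaxModificationsCorridor3.Sigma

end
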